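import Mathlib
import Literature.NumberTheory.LFunctions.SuzukiWeilHilbertSpace
import Literature.NumberTheory.LFunctions.LiCoefficientsModelSpaceRH
import Literature.NumberTheory.LFunctions.LagariasXiStructureFunctionProofs
import Literature.Analysis.DeBrangesSpaces.ReproducingKernelRealZeros
import Literature.Analysis.DeBrangesSpaces.HalfPlanePaleyWiener
import HarnessLib

/-!
# `𝓗(E_ξ) ⊆ E_ξ·𝖥(V(0))` under RH — one half of CJM Lemma 5.1 (ii)

LINE 1 — LABEL: RH-CONSEQUENCE proof (explicit binder `RiemannHypothesis →`), about the cell's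
RH-CONSEQUENCE fact `Suzuki2025_lemma51` (M. Suzuki, *On the Hilbert space derived from the Weil
distribution*, Canad. J. Math. 2025 = arXiv:2301.00421v3, Lemma 5.1: under RH,
`𝓗(E_ξ) = E_ξ𝖥(V(0))`). bears_on: B-C/B-P (LADDER-RH COLUMN 6 DBR) as corpus infrastructure.
WHAT THIS IS NOT: one inclusion of a printed RH-CONSEQUENCE structure lemma; the fact
`Suzuki2025_lemma51` (both inclusions) is NOT discharged here; nothing here bears on the truth of RH.

## What is proved

`deBrangesSpace_subset_suzukiChainSpace_zero (hRH) : ↑(DeBrangesSpace lagariasE) ⊆ suzukiChainSpace 0`: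
under RH, every `Φ` in the de Branges space `𝓗(E_ξ)` (the tree's pointwise characterization
`Literature.Analysis.DeBrangesSpaces.DeBrangesSpace`: `Φ` entire, `Φ/E ∈ L²(ℝ)`,
`|Φ(z)|² ≤ C·K(z,z)` off the real axis) is `E_ξ·ψ̂` on `ℂ₊` for some `ψ ∈ V(0)`.

Proof: `E = E_ξ` is Hermite–Biehler under RH ([La06] Thm. 1, `Lagarias2006_thm1_onlyif_holds`);
de Branges' removable-singularity lemma (`DeBrangesSpaces.exists_continuation_div`) continues `Φ/E`
to the closed upper half-plane; the kernel bound gives `|Φ(z)/E(z)|² ≤ C/(4π Im z)` on `ℂ₊`, so the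
boundary-regular Paley–Wiener theorem (`DeBrangesSpaces.integral_Ioi_fourierInv_mul_cexp_eq`,
`DeBrangesSpaces.fourierInv_ae_eq_zero_of_neg`) yields `ψ := 𝓕⁻¹((Φ/E)(−2π·)) ∈ L²(0,∞)` with
`ψ̂ = Φ/E` on `ℂ₊`; the same for `Φ♯ ∈ 𝓗(E)` gives `ψ′`, and on the line
`Θ·conj(Φ/E) = Φ♯/E`, i.e. `𝖪ψ = ψ′ ∈ L²(0,∞)` — so `ψ ∈ V(0) = L²(0,∞) ∩ 𝖪L²(0,∞)`.
This is the printed mechanism "`(𝖥𝖪ψ)(z) = Θ(z)(𝖥ψ)♯(z)` and (2.7)" of the proof of Lemma 5.1,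
read from the `𝓗(E)` side.

## References
* M. Suzuki, Canad. J. Math. 2025 = arXiv:2301.00421v3, Lemma 5.1 p. 13 (TeX l.1464–1496). [Suzuki2025WeilHilbertSpace]
* W. Rudin, *Real and complex analysis*, Thm. 19.2. [Rudin1987]
-/

noncomputable section

open MeasureTheory Complex Filter Set FourierTransform
open scoped ComplexConjugate FourierTransform Topology Real ENNReal InnerProductSpace

namespace Literature.NumberTheory.LFunctions

open ZetaZeros Literature.Analysis.DeBrangesSpaces

namespace SuzukiChainSpace

variable {Φ : ℂ → ℂ} {Q : ℂ → ℂ}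

/-- Under RH, `Φ/E_ξ` for `Φ ∈ 𝓗(E_ξ)` continues to the closed upper half-plane. RH-CONSEQUENCE.
[cite: Suzuki2025WeilHilbertSpace, CJM Lemma 5.1 p. 13 (TeX l.1464–1471)] -/
theorem exists_continuation (hRH : RiemannHypothesis) (hΦ : Φ ∈ DeBrangesSpace lagariasE) :
    ∃ Q : ℂ → ℂ, (∀ z : ℂ, 0 ≤ z.im → DifferentiableAt ℂ Q z) ∧
      ∀ z : ℂ, lagariasE z ≠ 0 → Q z = Φ z / lagariasE z := by
  have hE : IsHermiteBiehler lagariasE := Lagarias2006_thm1_onlyif_holds hRH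
  obtain ⟨hΦd, hΦ2, -⟩ := DeBrangesSpace.mem_iff.1 hΦ
  exact exists_continuation_div hE hΦd ((memLp_two_iff_integrable_sq_norm hΦ2.1).1 hΦ2)

/-- `∫_ℝ |Q|² < ∞` for the continuation `Q` of `Φ/E` (`Q = Φ/E` a.e. on `ℝ`).
[cite: Suzuki2025WeilHilbertSpace, CJM Lemma 5.1 p. 13 and eq. (2.4) (the 𝓗(E) norm ‖F/E‖_{L²(ℝ)})] -/
theorem integrable_sq_norm_continuation (hΦ : Φ ∈ DeBrangesSpace lagariasE)
    (hQ : ∀ z : ℂ, lagariasE z ≠ 0 → Q z = Φ z / lagariasE z) :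
    Integrable fun x : ℝ ↦ ‖Q x‖ ^ 2 := by
  obtain ⟨-, hΦ2, -⟩ := DeBrangesSpace.mem_iff.1 hΦ
  refine ((memLp_two_iff_integrable_sq_norm hΦ2.1).1 hΦ2).congr ?_
  filter_upwards [ae_lagariasE_ofReal_ne_zero] with x hx
  rw [hQ x hx]

/-- **Decay of `Φ/E` on `ℂ₊`** from the kernel bound: `|Φ(z)|² ≤ C·K(z,z) = C(|E(z)|²−|E(z̄)|²)/(4π Im z)`
gives `‖Q z‖ ≤ √(max C 0/(4π))/√(Im z)`. RH-CONSEQUENCE (through `E ≠ 0` on `ℂ₊`).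
[cite: Suzuki2025WeilHilbertSpace, CJM §2.2 eq. (2.4)–(2.6) p. 4 (reproducing kernel of 𝓗(E))] -/
theorem norm_continuation_le (hRH : RiemannHypothesis) (hΦ : Φ ∈ DeBrangesSpace lagariasE)
    (hQ : ∀ z : ℂ, lagariasE z ≠ 0 → Q z = Φ z / lagariasE z) :
    ∃ C : ℝ, 0 ≤ C ∧ ∀ z : ℂ, 0 < z.im → (0 : ℝ) ≤ ‖z‖ → ‖Q z‖ ≤ C / √z.im := by
  obtain ⟨-, -, C, hC⟩ := DeBrangesSpace.mem_iff.1 hΦ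
  refine ⟨√(max C 0 / (4 * π)), Real.sqrt_nonneg _, fun z hz _ ↦ ?_⟩
  have hE : lagariasE z ≠ 0 := lagariasE_ne_zero_of_im_pos hRH hz
  have hEpos : 0 < ‖lagariasE z‖ := norm_pos_iff.2 hE
  have hK := hC z hz.ne'
  -- `K(z,z) ≤ ‖E z‖²/(4π Im z)`
  have hKle : deBrangesKernelDiag lagariasE z ≤ ‖lagariasE z‖ ^ 2 / (4 * π * z.im) := by
    unfold deBrangesKernelDiag
    gcongr
    linarith [sq_nonneg ‖lagariasE (conj z)‖]
  have hΦsq : ‖Φ z‖ ^ 2 ≤ max C 0 * (‖lagariasE z‖ ^ 2 / (4 * π * z.im)) := by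
    refine hK.trans ?_
    have hKnn : 0 ≤ deBrangesKernelDiag lagariasE z :=
      ((Lagarias2006_thm1_onlyif_holds hRH).deBrangesKernelDiag_pos hz.ne').le
    calc C * deBrangesKernelDiag lagariasE z ≤ max C 0 * deBrangesKernelDiag lagariasE z :=
          mul_le_mul_of_nonneg_right (le_max_left _ _) hKnn
      _ ≤ max C 0 * (‖lagariasE z‖ ^ 2 / (4 * π * z.im)) :=
          mul_le_mul_of_nonneg_left hKle (le_max_right _ _)
  have hQz : ‖Q z‖ = ‖Φ z‖ / ‖lagariasE z‖ := by rw [hQ z hE, norm_div]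
  have hsq : ‖Q z‖ ^ 2 ≤ (√(max C 0 / (4 * π)) / √z.im) ^ 2 := by
    rw [hQz, div_pow, div_pow, Real.sq_sqrt (by positivity), Real.sq_sqrt hz.le,
      div_le_iff₀ (by positivity)]
    refine hΦsq.trans_eq ?_
    field_simp
  exact (pow_le_pow_iff_left₀ (norm_nonneg _) (by positivity) two_ne_zero).1 hsq

/-- The Fourier-side class of the continuation is in `L²(ℝ)`. [cite: Suzuki2025WeilHilbertSpace, CJM Lemma 5.1 p. 13] -/
theorem memLp_two_continuation_dilate (hΦ : Φ ∈ DeBrangesSpace lagariasE)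
    (hQd : ∀ z : ℂ, 0 ≤ z.im → DifferentiableAt ℂ Q z)
    (hQ : ∀ z : ℂ, lagariasE z ≠ 0 → Q z = Φ z / lagariasE z) :
    MemLp (fun ξ : ℝ ↦ Q ((-(2 * π) * ξ : ℝ) : ℂ)) 2 volume :=
  memLp_two_boundary_dilate hQd (integrable_sq_norm_continuation hΦ hQ)

/-- **`ψ := 𝓕⁻¹((Φ/E)(−2π·)) ∈ L²(0,∞)` with `ψ̂ = Φ/E` on `ℂ₊`** (boundary-regular Paley–Wiener).
RH-CONSEQUENCE. [cite: Suzuki2025WeilHilbertSpace, CJM Lemma 5.1 p. 13 (TeX l.1474–1482: "𝖥ψ ∈ H²")] -/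
theorem fourierInv_mem_halfLineL2_and_upperHalfHat (hRH : RiemannHypothesis)
    (hΦ : Φ ∈ DeBrangesSpace lagariasE)
    (hQd : ∀ z : ℂ, 0 ≤ z.im → DifferentiableAt ℂ Q z)
    (hQ : ∀ z : ℂ, lagariasE z ≠ 0 → Q z = Φ z / lagariasE z)
    (hQ2 : MemLp (fun ξ : ℝ ↦ Q ((-(2 * π) * ξ : ℝ) : ℂ)) 2 volume) :
    (𝓕⁻ (hQ2.toLp _ : Lp ℂ 2 (volume : Measure ℝ)) : Lp ℂ 2 (volume : Measure ℝ)) ∈ halfLineL2 0 ∧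
      ∀ w : ℂ, 0 < w.im →
        upperHalfHat (𝓕⁻ (hQ2.toLp _ : Lp ℂ 2 (volume : Measure ℝ)) : Lp ℂ 2 (volume : Measure ℝ)) w
          = Φ w / lagariasE w := by
  obtain ⟨C, hC, hb⟩ := norm_continuation_le hRH hΦ hQ
  have hi := integrable_sq_norm_continuation hΦ hQ
  refine ⟨fourierInv_ae_eq_zero_of_neg hC hQd hi hb hQ2, fun w hw ↦ ?_⟩
  rw [← hQ w (lagariasE_ne_zero_of_im_pos hRH hw)]
  exact integral_Ioi_fourierInv_mul_cexp_eq hC hQd hi hb hQ2 hw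

/-- On the real line, off the zeros of `E`: **`Θ(x)·conj(Φ(x)/E(x)) = Φ♯(x)/E(x)`** — the printed
"`(𝖥𝖪ψ)(z) = Θ(z)(𝖥ψ)♯(z)`" read for `𝖥ψ = Φ/E`. RH-FREE identity.
[cite: Suzuki2025WeilHilbertSpace, CJM Lemma 5.1 proof p. 13 (TeX l.1480–1482) and eq. (5.1)] -/
theorem lagariasTheta_mul_conj_div {x : ℝ} (hE : lagariasE (x : ℂ) ≠ 0) (Φ : ℂ → ℂ) :
    lagariasTheta x * conj (Φ x / lagariasE x) = sharp Φ x / lagariasE x := by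
  have hEs : sharp lagariasE (x : ℂ) ≠ 0 := by
    rw [sharp_ofReal]; exact (map_ne_zero _).2 hE
  rw [lagariasTheta, map_div₀, ← sharp_ofReal, ← sharp_ofReal]
  field_simp

end SuzukiChainSpace

open SuzukiChainSpace in
/-- **CJM Lemma 5.1 (ii), the inclusion `𝓗(E_ξ) ⊆ E_ξ𝖥(V(0))`, under RH**: every `Φ` in the de
Branges space of `E_ξ` is `E_ξ·ψ̂` on `ℂ₊` for some `ψ ∈ V(0)` (namely `ψ = 𝖥⁻¹(Φ/E)`, with
`𝖪ψ = 𝖥⁻¹(Φ♯/E)`). RH-CONSEQUENCE, PROVED; the reverse inclusion (and hence the fact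
`Suzuki2025_lemma51`) is NOT proved here.
[cite: Suzuki2025WeilHilbertSpace, CJM Lemma 5.1 p. 13 (TeX l.1464–1496) (= arXiv v1 Thm. 1.2 (1))] -/
theorem deBrangesSpace_subset_suzukiChainSpace_zero (hRH : RiemannHypothesis) :
    (DeBrangesSpace lagariasE : Set (ℂ → ℂ)) ⊆ suzukiChainSpace 0 := by
  intro Φ hΦ
  have hΦ' : Φ ∈ DeBrangesSpace lagariasE := hΦ
  have hΦd : Differentiable ℂ Φ := DeBrangesSpace.differentiable_of_mem hΦ'
  -- the continuations of `Φ/E` and `Φ♯/E`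
  have hΦs : sharp Φ ∈ DeBrangesSpace lagariasE :=
    DeBrangesSpace.sharp_mem differentiable_lagariasE hΦ'
  obtain ⟨Q, hQd, hQ⟩ := exists_continuation hRH hΦ'
  obtain ⟨Q', hQ'd, hQ'⟩ := exists_continuation hRH hΦs
  have hQ2 := memLp_two_continuation_dilate hΦ' hQd hQ
  have hQ'2 := memLp_two_continuation_dilate hΦs hQ'd hQ'
  set ψ : Lp ℂ 2 (volume : Measure ℝ) := 𝓕⁻ (hQ2.toLp _ : Lp ℂ 2 (volume : Measure ℝ)) with hψ
  set ψ' : Lp ℂ 2 (volume : Measure ℝ) := 𝓕⁻ (hQ'2.toLp _ : Lp ℂ 2 (volume : Measure ℝ)) with hψ'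
  obtain ⟨hψ0, hψhat⟩ := fourierInv_mem_halfLineL2_and_upperHalfHat hRH hΦ' hQd hQ hQ2
  obtain ⟨hψ'0, -⟩ := fourierInv_mem_halfLineL2_and_upperHalfHat hRH hΦs hQ'd hQ' hQ'2
  -- `𝖪ψ = ψ'`
  have hK : suzukiK ψ = ψ' := by
    have hq : Measure.QuasiMeasurePreserving (fun ξ : ℝ ↦ -(2 * π) * ξ) volume volume := by
      refine ⟨measurable_const_mul _, ?_⟩
      rw [Real.map_volume_mul_left (neg_ne_zero.2 Real.two_pi_pos.ne')]
      exact Measure.smul_absolutelyContinuous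
    have hae : ∀ᵐ ξ : ℝ, suzukiMultiplier ξ * conj (Q ((-(2 * π) * ξ : ℝ) : ℂ)) =
        Q' ((-(2 * π) * ξ : ℝ) : ℂ) := by
      filter_upwards [hq.ae ae_lagariasE_ofReal_ne_zero] with ξ hξ
      have e : ((-2 * Real.pi * ξ : ℝ) : ℂ) = ((-(2 * π) * ξ : ℝ) : ℂ) := by push_cast; ring
      rw [suzukiMultiplier, e, hQ _ hξ, hQ' _ hξ]
      exact lagariasTheta_mul_conj_div hξ Φ
    have hMJ : suzukiM (suzukiJ (hQ2.toLp _ : Lp ℂ 2 (volume : Measure ℝ))) =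
        (hQ'2.toLp _ : Lp ℂ 2 (volume : Measure ℝ)) := by
      refine Lp.ext ?_
      filter_upwards [coeFn_suzukiM (suzukiJ (hQ2.toLp _ : Lp ℂ 2 (volume : Measure ℝ))),
        coeFn_suzukiJ (hQ2.toLp _ : Lp ℂ 2 (volume : Measure ℝ)), hQ2.coeFn_toLp, hQ'2.coeFn_toLp,
        hae] with ξ h1 h2 h3 h4 h5
      rw [h1, h2, h3, h4, h5]
    rw [hψ, hψ', suzukiK, fourier_fourierInv_eq, hMJ]
  -- `ψ ∈ V(0)` and `Φ = E ψ̂` on `ℂ₊`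
  have hV : ψ ∈ suzukiV 0 := mem_suzukiV_iff.2 ⟨hψ0, by rw [hK]; exact hψ'0⟩
  refine ⟨hΦd, ψ, hV, fun z hz ↦ ?_⟩
  rw [hψhat z hz, mul_div_cancel₀ _ (lagariasE_ne_zero_of_im_pos hRH hz)]

end Literature.NumberTheory.LFunctions
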